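import Summits.Parity.GeneralizedHardyLittlewood.Theorems.PrimeLevelFamEdgeMomentsBeyondDiagonalDiagRemZeroFourEstimate
import Summits.Parity.GeneralizedHardyLittlewood.Theorems.PrimeLevelFamEdgeMomentsBeyondDiagonalDiagDecorOrderZeroFourTarget
import HarnessLib

/-!
# Route `PrimeLevelFamEdge`, crux K_A `MomentsBeyondDiagonal` (stmt-Parity-20007), line «petersson_layers» v4, stub `stub_diag`:
# **THE ORDER-`(0,4)` TARGET OF `stub_diag` IS UNCONDITIONAL** (first order of rung `N = 4`)

Composition of `…DiagRemZeroFourEstimate.remainder_estimate₀₄` ((R₀₄), this lineage) with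
`…DiagDecorOrderZeroFourTarget.orderZeroFour_target_of_remainder` ((Poly₀₄) unconditional, lineage famedge-2 g6):

* `orderZeroFour_target` — **the order-`(0,4)` target of `…DiagOrderSelberg.subDiag_of_selbergOrderAsymptotics(_of_le)`
  (`τ₀₄(Δ′,P) = Δ′²·(Δ′²𝔎₀₄(1/Δ′,P))/(2(π²/6)²)`, `𝔎₀₄ = (π²/6)²(Φ₅/160 + Ψ₃/8 + (3/16)Ξ₁)`) on every window `(1, Δ]`, `Δ ≤ 3/2`,
  with NO hypothesis left** (by `…DiagOrderSymm.selbergOrder_symm` also the order `(4,0)`).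

Towards rung `N = 4` of `stub_diag` the orders `(2,4)` [⟸ (R₂₄) alone, `…DiagOrderTwoFourOfR24`] and `(4,4)` [famedge-2: `M₈`, `M₆⊗P₂`,
`M₄⊗M₄` engines landed; chain + (R₄₄) open] remain. Def-free; theorems only. Helper `--supports stmt-Parity-20007`; closes nothing
(`stub_diag : SubDiag` quantifies over every `Q`); K_A, K_B and the Parity summit are NOT proved; nothing about Landau–Siegel zeros.

## References
* E. Kowalski, P. Michel, J. VanderKam, J. reine angew. Math. 526 (2000), (23)–(28) pp. 13–15, Prop. 5.1 (31) p. 18.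
  [cite: KowalskiMichelVanderKam2000, (23)–(28) pp. 13–15 — derivation (diagonal main term, order (0,4), general Q)]
-/

noncomputable section

open scoped Real ArithmeticFunction.Moebius
open Complex MeasureTheory Polynomial Finset ArithmeticFunction Set intervalIntegral
open Literature.NumberTheory.LFunctions Literature.NumberTheory.LFunctions.KMV2000

namespace Summit.Parity.GeneralizedHardyLittlewood.Theorems.MomentsBeyondDiagonal.DiagCorner

open Summit.Parity.GeneralizedHardyLittlewood.Theorems.MomentsBeyondDiagonal.DiagKernel (orderZeroFour_target_of_remainder)

set_option maxHeartbeats 800000 in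
-- large statement
/-- **THE ORDER-`(0,4)` TARGET OF `stub_diag`, UNCONDITIONAL** (window `(1, Δ]`, any `Δ ≤ 3/2`).
[cite: KowalskiMichelVanderKam2000, (23)–(28) and Prop. 5.1 — derivation (order-(0,4) piece of the diagonal, general Q)] -/
theorem orderZeroFour_target {Δ : ℝ} (hΔ : Δ ≤ 3 / 2) :
    ∀ P : ℝ[X], KMV2000.Admissible P → ∀ Δ' : ℝ, 1 < Δ' → Δ' ≤ Δ →
      ∃ C : ℝ, ∃ q₀ : ℕ, ∀ (q : ℕ) [NeZero q], q₀ ≤ q →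
        |(Real.log (qhat q))⁻¹ ^ (0 + 4) * qhat q *
          (∑ c ∈ Icc 1 ⌊qhat q ^ Δ'⌋₊, ∑ g ∈ Icc 1 (⌊qhat q ^ Δ'⌋₊ / c), (μ g : ℝ) * c *
        ∑ k₁ ∈ Icc 1 (⌊qhat q ^ Δ'⌋₊ / (c * g)), ∑ k₂ ∈ Icc 1 (⌊qhat q ^ Δ'⌋₊ / (c * g)),
          ((μ (c * g * k₁) : ℝ) * ((psi (c * g * k₁))⁻¹ *
              P.eval (Real.log (qhat q ^ Δ' / ((c * g * k₁ : ℕ) : ℝ)) / Real.log (qhat q ^ Δ'))) / ((c * g * k₁ : ℕ) : ℝ)) *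
            ((μ (c * g * k₂) : ℝ) * ((psi (c * g * k₂))⁻¹ *
              P.eval (Real.log (qhat q ^ Δ' / ((c * g * k₂ : ℕ) : ℝ)) / Real.log (qhat q ^ Δ'))) / ((c * g * k₂ : ℕ) : ℝ)) *
            (∑ d ∈ k₁.divisors, ∑ e ∈ k₂.divisors,
              ∫ u₁ in Ioi (0 : ℝ),
                (Real.log (qhat q / ((k₁ / d * (g * e) : ℕ) : ℝ)) + Real.log u₁) ^ 0 *
                ∫ u₂ in Ioi ((((k₁ / d * (g * e) * (g * d * (k₂ / e)) : ℕ) : ℝ) / qhat q ^ 2) / u₁),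
                  Real.exp (-(u₁ + u₂)) / (1 - Real.exp (-(u₁ + u₂))) ^ 2 *
                  (Real.log (qhat q / ((g * d * (k₂ / e) : ℕ) : ℝ)) + Real.log u₂) ^ 4)) -
          2 * (π ^ 2 / 6) ^ 2 * (qhat q / (Δ' ^ 2 * Real.log (qhat q) ^ 2)) *
            (Δ' ^ 2 * (Δ' ^ 2 * ((π ^ 2 / 6) ^ 2 * ((1 / 160) * (∑ j ∈ Finset.range (5 + 1), ∑ i ∈ Finset.range (j + 1),
            ((5 : ℕ).choose j : ℝ) * (j.choose i : ℝ) * 2 ^ (5 - j) *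
              ∫ u in (0 : ℝ)..1, (((Polynomial.C (1 / Δ') - X) ^ (5 - j) * derivative (derivative (X ^ i * P))) *
                derivative (derivative (X ^ (j - i) * P))).eval u) +
          (1 / 8) * (∑ j ∈ Finset.range (3 + 1), ∑ i ∈ Finset.range (j + 1),
            ((3 : ℕ).choose j : ℝ) * (j.choose i : ℝ) * 2 ^ (3 - j) *
              ∫ u in (0 : ℝ)..1, (((Polynomial.C (1 / Δ') - X) ^ (3 - j) * (-(2 : ℝ) • (X ^ i * P))) *
                derivative (derivative (X ^ (j - i) * P))).eval u) +
          (3 / 16) * (∑ j ∈ Finset.range (1 + 1), ∑ i ∈ Finset.range (j + 1),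
            ((1 : ℕ).choose j : ℝ) * (j.choose i : ℝ) * 2 ^ (1 - j) *
              ∫ u in (0 : ℝ)..1, (((Polynomial.C (1 / Δ') - X) ^ (1 - j) * (-(2 : ℝ) • (X ^ i * P))) *
                (-(2 : ℝ) • (X ^ (j - i) * P))).eval u)))) / (2 * (π ^ 2 / 6) ^ 2))| ≤
          C * qhat q * (Real.log (qhat q))⁻¹ ^ 3 := by
  refine orderZeroFour_target_of_remainder (Δ := Δ) ?_
  obtain ⟨E₀₀, E₀₁, E₀₂, E₀₃, E₀₄, μ₂, μ₄, h⟩ := remainder_estimate₀₄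
  exact ⟨E₀₀, E₀₁, E₀₂, E₀₃, E₀₄, μ₂, μ₄, fun P hP Δ' h1 h2 ↦ h P hP Δ' h1 (h2.trans hΔ)⟩

end Summit.Parity.GeneralizedHardyLittlewood.Theorems.MomentsBeyondDiagonal.DiagCorner

end
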